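import Literature.Algebra.EuclideanLattices.DiscreteGaussianInt
import Mathlib.Analysis.SpecialFunctions.Gaussian.PoissonSummation
import Mathlib.Analysis.SpecialFunctions.Gaussian.GaussianIntegral
import Mathlib.Analysis.SumIntegralComparisons
import HarnessLib

/-!
# The Gaussian mass of the integers: `s ≤ ρ_s(ℤ) ≤ 1 + s` (Poisson summation; integral comparison) and the mass formula of `D_{ℤ,s}` in `ℝ`

Topic `Algebra/EuclideanLattices` (family `pqc`; sequel of `DiscreteGaussianInt.lean`). Everything here is
PROVED; no definition, no named fact. Notation: `ρ_s(x) = exp(−π x²/s²)` is `gaussianFunction s x`,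
`ρ_s(ℤ) = Σ_{k ∈ ℤ} ρ_s(k)`, `D_{ℤ,s} = discreteGaussianInt s 0`.

* `gaussianFunction_intCast_eq` — `ρ_t(k) = exp(−(π/t²)·k²)` at an integer `k`;
  `summable_gaussianFunction_int` — `k ↦ ρ_t(k)` is summable over `ℤ` (`t ≠ 0`).
* **`le_tsum_gaussianFunction_int`** — `s ≤ ρ_s(ℤ)` for every `s > 0`: Jacobi's transformation formula
  `Σ_n e^{−πan²} = a^{−1/2} Σ_n e^{−πn²/a}` (Mathlib `Real.tsum_exp_neg_mul_int_sq`; Banaszczyk 1993,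
  Lemma 1.1 (i) for the lattice `ℤ`: `ρ_s(ℤ) = s·ρ_{1/s}(ℤ)`) and `ρ_{1/s}(ℤ) ≥ ρ_{1/s}(0) = 1`;
  `one_le_tsum_gaussianFunction_int` (`1 ≤ ρ_s(ℤ)`, the `k = 0` term), `tsum_gaussianFunction_int_pos`.
* **`tsum_gaussianFunction_int_le_one_add`** — `ρ_s(ℤ) ≤ 1 + s` for every `s > 0`: `ρ_s` is even and
  decreasing on `[0, ∞)`, so `Σ_{k ≥ 1} ρ_s(k) ≤ ∫_0^∞ ρ_s = s/2` (the remainder estimate of the integral test,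
  `R_0 = a_1 + a_2 + ⋯ ≤ ∫_0^∞ f(x) dx` [Stewart2012, §11.3]; Mathlib `AntitoneOn.sum_le_integral_Ico` and
  `integral_gaussian_Ioi`), and `ρ_s(ℤ) = 1 + 2 Σ_{k ≥ 1} ρ_s(k)`; also in the raw spelling
  `Σ'_{k∈ℤ} exp(−π k²/s²) ≤ 1 + s` (`tsum_exp_neg_pi_sq_div_le_one_add`, with `summable_exp_neg_pi_sq_div`) and for
  every finite window `Σ_{k∈W} exp(−π k²/s²) ≤ 1 + s` (`sum_exp_neg_pi_sq_div_le_one_add`) — the form the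
  QA-LWE line «edcp-width-information-floor» consumes (`BKSW18.gaussRho r j` unfolds to this spelling).
* `gaussianMassInt_zero_eq` — the `ℝ≥0∞` mass `gaussianMassInt s 0` is `ofReal ρ_s(ℤ)`;
  **`toReal_discreteGaussianInt_zero`** — the mass formula in `ℝ`: `D_{ℤ,s}(k) = ρ_s(k)/ρ_s(ℤ)` (`0 < s`).

These are the inputs of Rényi / KL computations against `D_{ℤ,s}` on finite windows (e.g. the ML-DSA
uniform-`η` floor, `Summits/Ventures/PQCSecurity/QALWE/MLDSAUniformEtaRenyiFloor.lean`). A `HasSum` form of the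
mass at general `S > 0` also exists under heavier imports as
`Literature.Computability.Cryptography.hasSum_gaussianFunction_intCast` (`FloorGaussianSampling.lean`); the
lattice-general Poisson identity is `tsum_gaussianFunction_eq` (`GaussianLatticeSums.lean`, needs the covolume);
here only Mathlib's one-dimensional formula is used. NOT here: centred versions `c ≠ 0` (then `ρ_{s,c}(ℤ) ≤ ρ_s(ℤ)`,
`GaussianLatticeSums.tsum_gaussianFunction_sub_le`), the sharper Poisson-side upper bound
`ρ_s(ℤ) ≤ s(1 + 2e^{−πs²}/(1 − e^{−πs²}))` for `s ≥ 1`.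

References: W. Banaszczyk, *New bounds in some transference theorems in the geometry of numbers*, Math. Ann.
296 (1993), Lemma 1.1 [Banaszczyk1993]; D. Micciancio, O. Regev, SIAM J. Comput. 37 (2007), §2
[MicciancioRegev2007]; C. Gentry, C. Peikert, V. Vaikuntanathan, STOC 2008, §4.1 [GentryPeikertVaikuntanathan2008];
J. Stewart, *Calculus: Early Transcendentals*, 7th ed. (2012), §11.3 “The Integral Test and Estimates of Sums”,
Remainder Estimate for the Integral Test: “`R_n = a_{n+1} + a_{n+2} + ⋯ ≤ ∫_n^∞ f(x) dx`” for `f` continuous,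
positive, decreasing (held text `book:stewart2012-calculus-early-transcendentals-single-variable`, chunk p0505)
[Stewart2012].
-/

noncomputable section

open scoped ENNReal

namespace Literature.Algebra.EuclideanLattices

/-- `ρ_t(k) = exp(−(π/t²)·k²)` at an integer `k` (`‖(k : ℝ)‖² = k²`). [cite: MicciancioRegev2007, §2] -/
theorem gaussianFunction_intCast_eq (t : ℝ) (k : ℤ) :
    gaussianFunction t (k : ℝ) = Real.exp (-Real.pi / t ^ 2 * (k : ℝ) ^ 2) := by
  rw [gaussianFunction, Real.norm_eq_abs, sq_abs]
  congr 1
  ring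

/-- `k ↦ ρ_t(k)` is summable over `ℤ` for `t ≠ 0` (the tree's `summable_gaussianFunction_sub` for the lattice
`ℤ ⊂ ℝ`, transported along `intLatticeEquiv`). [cite: MicciancioRegev2007, §2] -/
theorem summable_gaussianFunction_int {t : ℝ} (ht : t ≠ 0) :
    Summable fun k : ℤ => gaussianFunction t (k : ℝ) := by
  have h := (intLatticeEquiv.summable_iff
    (f := fun x : intLattice => gaussianFunction t ((x : ℝ) - 0))).2
    (summable_gaussianFunction_sub intLattice ht 0)
  refine h.congr fun k => ?_
  simp only [Function.comp_apply, coe_intLatticeEquiv, sub_zero]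

/-- `1 ≤ ρ_t(ℤ)` for `t ≠ 0` (the term `k = 0` is `1`, the others are nonnegative). [cite: MicciancioRegev2007, §2] -/
theorem one_le_tsum_gaussianFunction_int {t : ℝ} (ht : t ≠ 0) :
    1 ≤ ∑' k : ℤ, gaussianFunction t (k : ℝ) := by
  have h := (summable_gaussianFunction_int ht).le_tsum 0 (fun j _ => (gaussianFunction_pos _ _).le)
  simpa using h

/-- **`s ≤ ρ_s(ℤ) = Σ_{k ∈ ℤ} exp(−π k²/s²)` for every `s > 0`**: Jacobi's transformation / Poisson summation
`Σ_n e^{−πan²} = a^{−1/2} Σ_n e^{−πn²/a}` (Mathlib `Real.tsum_exp_neg_mul_int_sq`) at `a = s²` reads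
`ρ_s(ℤ) = s·ρ_{1/s}(ℤ)`, and `ρ_{1/s}(ℤ) ≥ 1`. [cite: Banaszczyk1993, Lemma 1.1] -/
theorem le_tsum_gaussianFunction_int {s : ℝ} (hs : 0 < s) :
    s ≤ ∑' k : ℤ, gaussianFunction s (k : ℝ) := by
  have hP := Real.tsum_exp_neg_mul_int_sq (a := s ^ 2) (by positivity)
  have e1 : (fun n : ℤ => Real.exp (-Real.pi * s ^ 2 * (n : ℝ) ^ 2)) =
      fun n : ℤ => gaussianFunction s⁻¹ (n : ℝ) := by
    funext n
    rw [gaussianFunction_intCast_eq]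
    congr 1
    field_simp
  have e2 : (fun n : ℤ => Real.exp (-Real.pi / s ^ 2 * (n : ℝ) ^ 2)) =
      fun n : ℤ => gaussianFunction s (n : ℝ) := by
    funext n
    rw [gaussianFunction_intCast_eq]
  have hroot : (s ^ 2) ^ (1 / 2 : ℝ) = s := by
    rw [← Real.sqrt_eq_rpow, Real.sqrt_sq hs.le]
  rw [e1, e2, hroot] at hP
  have e3 : ∑' n : ℤ, gaussianFunction s (n : ℝ) = s * ∑' n : ℤ, gaussianFunction s⁻¹ (n : ℝ) := by
    rw [hP]
    field_simp
  rw [e3]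
  exact le_mul_of_one_le_right hs.le (one_le_tsum_gaussianFunction_int (inv_ne_zero hs.ne'))

/-- `0 < ρ_s(ℤ)` for `s > 0`. [cite: MicciancioRegev2007, §2] -/
theorem tsum_gaussianFunction_int_pos {s : ℝ} (hs : 0 < s) :
    0 < ∑' k : ℤ, gaussianFunction s (k : ℝ) :=
  hs.trans_le (le_tsum_gaussianFunction_int hs)

/-- `ρ_s(ℤ)` as an `ℝ≥0∞` sum (`gaussianMassInt s 0`) is `ofReal` of the real sum (`0 < s`).
[cite: MicciancioRegev2007, §2] -/
theorem gaussianMassInt_zero_eq {s : ℝ} (hs : 0 < s) :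
    gaussianMassInt s 0 = ENNReal.ofReal (∑' k : ℤ, gaussianFunction s (k : ℝ)) := by
  rw [gaussianMassInt, ENNReal.ofReal_tsum_of_nonneg (fun k => (gaussianFunction_pos _ _).le)
    (summable_gaussianFunction_int hs.ne')]
  simp only [sub_zero]

/-- **Mass formula in `ℝ`**: `D_{ℤ,s}(k) = ρ_s(k)/ρ_s(ℤ)` for `0 < s` and centre `0` (the tree's
`discreteGaussianInt_apply`, transported from `ℝ≥0∞`). [cite: GentryPeikertVaikuntanathan2008, §4.1] -/
theorem toReal_discreteGaussianInt_zero {s : ℝ} (hs : 0 < s) (k : ℤ) :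
    (discreteGaussianInt s 0 k).toReal =
      gaussianFunction s (k : ℝ) / ∑' n : ℤ, gaussianFunction s (n : ℝ) := by
  rw [discreteGaussianInt_apply hs, gaussianMassInt_zero_eq hs, sub_zero, ENNReal.toReal_mul,
    ENNReal.toReal_inv, ENNReal.toReal_ofReal (gaussianFunction_pos _ _).le,
    ENNReal.toReal_ofReal (tsum_gaussianFunction_int_pos hs).le, div_eq_mul_inv]

/-! ## The upper bound `ρ_s(ℤ) ≤ 1 + s` (integral comparison) -/

/-- `x ↦ exp(−π x²/s²)` is decreasing on `[0, ∞)` (here on `[0, N]`). [cite: MicciancioRegev2007, §2 (ρ_s)] -/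
theorem antitoneOn_exp_neg_pi_sq_div (s : ℝ) (N : ℝ) :
    AntitoneOn (fun x : ℝ => Real.exp (-(Real.pi * x ^ 2 / s ^ 2))) (Set.Icc 0 N) := by
  intro x hx y _ hxy
  have hx0 : 0 ≤ x := hx.1
  apply Real.exp_le_exp.mpr
  apply neg_le_neg
  gcongr

/-- **Remainder estimate of the integral test for `ρ_s`**: for `s > 0` and every `N`,
`Σ_{k=1}^{N} exp(−π k²/s²) ≤ ∫_0^∞ exp(−π x²/s²) dx = s/2`. [cite: Stewart2012, §11.3 Remainder Estimate for the Integral Test (R_n ≤ ∫_n^∞ f, at n = 0)] -/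
theorem sum_range_exp_neg_pi_sq_div_le {s : ℝ} (hs : 0 < s) (N : ℕ) :
    ∑ i ∈ Finset.range N, Real.exp (-(Real.pi * ((i : ℝ) + 1) ^ 2 / s ^ 2)) ≤ s / 2 := by
  set f : ℝ → ℝ := fun x => Real.exp (-(Real.pi * x ^ 2 / s ^ 2)) with hf
  have hb : 0 < Real.pi / s ^ 2 := by positivity
  have hfb : f = fun x => Real.exp (-(Real.pi / s ^ 2) * x ^ 2) := by
    funext x; rw [hf]; ring_nf
  -- the finite sum against the integral over `[0, N]`
  have h1 : ∑ i ∈ Finset.range N, f ((i : ℝ) + 1) ≤ ∫ x in (0 : ℝ)..N, f x := by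
    have h := AntitoneOn.sum_le_integral_Ico (f := f) (Nat.zero_le N)
      (by simpa using antitoneOn_exp_neg_pi_sq_div s N)
    simpa using h
  -- the integral over `[0, N]` against the half-line Gaussian integral `= s/2`
  have hInt : MeasureTheory.IntegrableOn f (Set.Ioi 0) := by
    rw [hfb]; exact (integrable_exp_neg_mul_sq hb).integrableOn
  have h2 : ∫ x in (0 : ℝ)..N, f x ≤ ∫ x in Set.Ioi 0, f x := by
    rw [intervalIntegral.integral_of_le (Nat.cast_nonneg N)]
    exact MeasureTheory.setIntegral_mono_set hInt
      (Filter.Eventually.of_forall fun x => (Real.exp_pos _).le)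
      Set.Ioc_subset_Ioi_self.eventuallyLE
  have h3 : ∫ x in Set.Ioi 0, f x = s / 2 := by
    rw [hfb, integral_gaussian_Ioi]
    have : Real.pi / (Real.pi / s ^ 2) = s ^ 2 := by field_simp
    rw [this, Real.sqrt_sq hs.le]
  calc ∑ i ∈ Finset.range N, Real.exp (-(Real.pi * ((i : ℝ) + 1) ^ 2 / s ^ 2))
      = ∑ i ∈ Finset.range N, f ((i : ℝ) + 1) := rfl
    _ ≤ s / 2 := h1.trans (h2.trans h3.le)

/-- `k ↦ exp(−π k²/s²)` is summable over `ℤ` (`s > 0`) — the raw spelling of `summable_gaussianFunction_int`.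
[cite: MicciancioRegev2007, §2 (ρ_s)] -/
theorem summable_exp_neg_pi_sq_div {s : ℝ} (hs : 0 < s) :
    Summable fun k : ℤ => Real.exp (-(Real.pi * (k : ℝ) ^ 2 / s ^ 2)) := by
  refine (summable_gaussianFunction_int hs.ne').congr fun k => ?_
  rw [gaussianFunction_intCast_eq]
  congr 1
  ring

/-- **`Σ_{k∈ℤ} exp(−π k²/s²) ≤ 1 + s`** for every `s > 0`: the term `k = 0` is `1`, and each of the two tails
`Σ_{k≥1}` is at most `∫_0^∞ exp(−π x²/s²) dx = s/2` by the remainder estimate of the integral test.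
[cite: Stewart2012, §11.3 Remainder Estimate for the Integral Test; MicciancioRegev2007, §2 (ρ_s)] -/
theorem tsum_exp_neg_pi_sq_div_le_one_add {s : ℝ} (hs : 0 < s) :
    ∑' k : ℤ, Real.exp (-(Real.pi * (k : ℝ) ^ 2 / s ^ 2)) ≤ 1 + s := by
  set g : ℤ → ℝ := fun k => Real.exp (-(Real.pi * (k : ℝ) ^ 2 / s ^ 2)) with hg
  have hS : Summable g := summable_exp_neg_pi_sq_div hs
  -- the one-sided tail `n ↦ g (n+1)` and its mirror image
  set t : ℕ → ℝ := fun n => Real.exp (-(Real.pi * ((n : ℝ) + 1) ^ 2 / s ^ 2)) with ht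
  have ht0 : ∀ n, 0 ≤ t n := fun n => (Real.exp_pos _).le
  have htail : ∑' n, t n ≤ s / 2 :=
    Real.tsum_le_of_sum_range_le ht0 (sum_range_exp_neg_pi_sq_div_le hs)
  have hpos : (fun n : ℕ => g ((n : ℤ) + 1)) = t := by
    funext n; simp only [hg, ht]; push_cast; ring_nf
  have hneg : (fun n : ℕ => g (-((n : ℤ) + 1))) = t := by
    funext n; simp only [hg, ht]; push_cast; ring_nf
  have h1 : Summable fun n : ℕ => g n := hS.comp_injective Nat.cast_injective
  have h2 : Summable fun n : ℕ => g (-((n : ℤ) + 1)) :=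
    hS.comp_injective fun a b h => by simpa using h
  rw [tsum_of_nat_of_neg_add_one h1 h2, h1.tsum_eq_zero_add]
  have hg0 : g ((0 : ℕ) : ℤ) = 1 := by simp [hg]
  have hp' : ∑' n : ℕ, g ((↑(n + 1) : ℤ)) = ∑' n, t n := by
    rw [← hpos]; push_cast; rfl
  rw [hg0, hp', hneg]
  linarith

/-- Finite-window form: `Σ_{k∈W} exp(−π k²/s²) ≤ 1 + s` for every `s > 0` and every finite `W ⊆ ℤ`.
[cite: Stewart2012, §11.3 Remainder Estimate for the Integral Test; MicciancioRegev2007, §2 (ρ_s)] -/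
theorem sum_exp_neg_pi_sq_div_le_one_add {s : ℝ} (hs : 0 < s) (W : Finset ℤ) :
    ∑ k ∈ W, Real.exp (-(Real.pi * (k : ℝ) ^ 2 / s ^ 2)) ≤ 1 + s :=
  ((summable_exp_neg_pi_sq_div hs).sum_le_tsum W fun _ _ => (Real.exp_pos _).le).trans
    (tsum_exp_neg_pi_sq_div_le_one_add hs)

/-- **`ρ_s(ℤ) ≤ 1 + s`** for every `s > 0`, in the tree's `gaussianFunction` spelling (companion of
`le_tsum_gaussianFunction_int : s ≤ ρ_s(ℤ)`). [cite: Stewart2012, §11.3 Remainder Estimate for the Integral Test; MicciancioRegev2007, §2 (ρ_s)] -/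
theorem tsum_gaussianFunction_int_le_one_add {s : ℝ} (hs : 0 < s) :
    ∑' k : ℤ, gaussianFunction s (k : ℝ) ≤ 1 + s := by
  have e : (fun k : ℤ => gaussianFunction s (k : ℝ))
      = fun k : ℤ => Real.exp (-(Real.pi * (k : ℝ) ^ 2 / s ^ 2)) := by
    funext k; rw [gaussianFunction_intCast_eq]; congr 1; ring
  rw [e]
  exact tsum_exp_neg_pi_sq_div_le_one_add hs

end Literature.Algebra.EuclideanLattices

end
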